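import Literature.MathematicalPhysics.QuantumFieldTheory.King1986.MinimizerAliasRate
import HarnessLib

/-!
# King 1986, Proposition 3.8 (3.71), MOMENTUM-SPACE CORE FOR A GENERAL EXTRA FACTOR: the alias sums of the two-spacing
# difference of the modes of (4.19) carrying ONE MORE FACTOR `E(Q)` of polynomial size `‖Q‖^β` (the derivative factor
# `η⁻¹{exp[iηQ_μ] − 1}`, `β = 1`; the Hölder quotient `|x − y|^{−α}{1 − exp[iQ(y − x)]}`, `β = α`; their product,
# `β = 1 + α`) are `≤ C₁N^{−γ} + C₂δ^γ` whenever `β + γ < 2` — King's «for α + γ < 1» in one statement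

**Citation header (reproduction of PUBLISHED and PROVED work; seat `pub-ymgap-dag-n18-b` (g2) of the cell `pub-ymgap`,
Track-A node N18 = NE5 whose PRINTED MODEL of record is King's Prop. 3.8 ∕ 3.9; eleventh file of the seat's chain.  The
tree's `MinimizerAliasRate` (first line of (3.71)) and `MinimizerAliasRateDeriv` (second line) each hard-code their set
of factors; lines 3–4 of (3.71) add the Hölder quotient `∂_α`.  Rather than cloning the near∕central∕far analysis a
third and fourth time, this file proves it ONCE for an ABSTRACT pair of extra factors `E_A, E_B : (Fin d → ℝ) → ℂ` with
King's two bounds as hypotheses — size `‖E_B(Q)‖ ≤ c_E‖Q‖^β` and replacement `‖E_B(Q) − E_A(Q)‖ ≤ (r_EN^{−γ} + s_Eδ^γ)·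
‖Q‖^{β+γ}` — so that each remaining line is an instance (sequel `MinimizerTwoSpacingHolder`).)**
C. King, *The U(1) Higgs model. I. The continuum limit*, Commun. Math. Phys. **102** (1986) 649–677 [King1986], §3.4
Proposition 3.8 (3.71) p. 664 and §4 pp. 672–674, (4.19)–(4.31).  Page images READ AS IMAGES by this seat:
`b2b-balaban-template/king-renders/1986-cmp102-king-u1-higgs-I-p016-x2.png` (p. 664), `…-p024-x2.png` (p. 672),
`…-p025-x2.png` (p. 673).  King's paper is TEMPLATE LITERATURE (printed and proved `A = 0` mechanism); nothing here
is about Bałaban's covariant objects.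

**What King prints (verbatim, p. 672).**  «We have the identity (∂_α(x′,y′)∂^{η′}_μa_{k+n}G^{η′}_{k+n}Q^*_{k+n})(z) =
(2π)^{−d}∫dp′ Σ_lΣ_m e^{i(p′+l+m)(x′−z)}|x′ − y′|^{−α}{1 − exp[i(p′+l+m)(y′−x′)]}·(η)^{−1}{exp[iη′(p′+l+m)_μ] − 1}
{Δ^{(k+n)}(p′)u^{η′}_{k+n}(p′+l+m)Δ^{η′}(p′+l+m)^{−1}}, (4.19) … We have the following bounds: |u^{η′}_{k+n}(p′+l+m)| <
C Π_{μ=1}^d |p′_μ||(p′+l+m)_μ|^{−1}, (4.20)  |Δ^{(k+n)}(p′)Δ^{η′}(p′+l+m)^{−1}| ≦ C|p′|²|p′+l+m|^{−2}. (4.21)  Also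
(η′)^{−1}|exp[iη′(p′+l+m)_μ] − 1| ≦ C|(p′+l+m)_μ| and |x′ − y′|^{−α}|1 − exp[i(p′+l+m)(y′−x′)]| ≦ C|p′+l+m|^α, so the sum
over l, m is bounded by Σ_{l,m}|p′+l+m|^{α−1}Π_μ|(p′+l+m)_μ|^{−1} ≦ C for α < 1. (4.22)  We first bound the terms in (4.19)
with m ≠ 0 as follows: |(4.19); m ≠ 0| ≦ … ≦ CL^{−γk} for α + γ < 1. (4.23)  To analyze the m = 0 term in (4.19), we
successively replace each factor by the corresponding one in the expression for (∂_α(x,y)∂^η_μa_kG^η_kQ^*_k)(z) and bound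
the error. We must always be careful to keep enough negative powers of momentum so that the sum over l is bounded.»

**What this file PROVES (kernel; Mathlib + `MinimizerAliasRate`).**  A FACTORED MODE is `fmodeTerm Δ η M Q ξ E :=
modeTerm Δ η M Q ξ · E Q` (the first line's mode `Δ·u^η(Q)·Δ^η(Q)⁻¹·e^{iQ·ξ}` times an extra factor).  Hypotheses on the
two factor families, the MOMENTUM-POWER BOOKKEEPING of p. 672: `‖E_B(Q)‖ ≤ c_E‖Q‖^β` (size) and `‖E_B(Q) − E_A(Q)‖ ≤
(r_E·N^{−γ} + s_E·δ^γ)·‖Q‖^{β+γ}` (replacement), `0 ≤ β`, `0 ≤ γ ≤ 1`, `β + γ < 2`: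
* §1 `fmodeTerm_far_le` ∕ `sum_fmodeTerm_far_le` — THE FAR ALIASES: `‖T_B(Q)E_B(Q)‖ ≤ a(π/2)^d(π²/4)c_E·N^{−γ}·
  aliasTerm (β+γ−1) p′ k` at sup-distance `≥ N` (the trade `‖Q‖^{β−2} = ‖Q‖^{−γ}‖Q‖^{β+γ−2} ≤ N^{−γ}‖Q‖^{β+γ−2}`), summed
  `≤ … aliasConst d (β+γ−1)·N^{−γ}` — (4.22)∕(4.23) with King's `α − 1 ↦ β + γ − 2`, convergent iff `β + γ < 2`.
* §2 `norm_fmodeTerm_sub_near_le` — THE NEAR ALIASES: `T_BE_B − T_AE_A = (T_B − T_A)E_B + T_A(E_B − E_A)` with the first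
  line's `norm_modeTerm_sub_near_le` BY NAME and (4.20)–(4.21) (`modeAmp_alias_le`): `≤ (K₁^E N^{−γ} + K₂^E δ^γ)·
  aliasTerm (β+γ−1) p′ j` (`fnearRateConst`, `fnearPosConst`).
* §3 `norm_fmodeTerm_sub_central_le` — THE CENTRAL ALIAS (`‖p′‖ ≤ π`: `fcentralRateConst`, `fcentralPosConst`).
* §4 `alias_sums_two_spacing_factor_le` (digit bookkeeping of `MinimizerAliasRate` §4 by name; constants
  `fprop38RateConst`, `fprop38PosConst`) and, for King's symbols, **`king_prop38_factor_aliasSums`**: for `a > 0`,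
  `L ≥ 2`, `k, n ≥ 1`, `m² > 0`, `0 ≤ γ ≤ 1`, `0 ≤ β`, `β + γ < 2` and ANY factor families obeying the two bounds, the
  alias sums of the difference of the factored mode families are `≤ C₁^E·L^{−γk} + C₂^E·δ^γ`, uniformly in `p′`, `m²`, `n`.
  Instances (sequel): `E = 1` (`β = 0`: first line), `E(Q) = η⁻¹(e^{iηQ_μ} − 1)` (`β = 1`: second line,
  = `MinimizerAliasRateDeriv`), `E = ∂_α`-factor (`β = α`: third line), `E = ∂_α`-factor × derivative factor
  (`β = 1 + α`: fourth line, where `β + γ < 2` IS King's «α + γ < 1»).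

**NOT COVERED.**  The factor bounds themselves for the Hölder quotient on the torus and the torus assembly (sequel);
even `L`; `A ≠ 0`.  HONEST FRAMING: King's `A = 0` scalar MODEL of the NE5 «η-rate» mechanism — template literature,
explicit functions of finitely many lattice momenta; nothing about Bałaban's covariant objects; nothing continuum ∕
mass-gap ∕ Clay; count-neutral for the cell's 27 nodes.
-/

noncomputable section

open Real Finset

namespace Literature.MathematicalPhysics.QuantumFieldTheory.King1986

/-! ## §1 Factored modes and the far aliases -/

/-- Zone bookkeeping: `|q_μ| ≤ πN` for all `μ` and `0 < η′ ≤ N⁻¹` give `|η′q_μ| ≤ π`. [folklore] -/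
private theorem zone_of_le'' {d : ℕ} {N : ℝ} (hN : 0 < N) {η' : ℝ} (hη' : 0 < η') (hη'N : η' ≤ N⁻¹)
    {q : Fin d → ℝ} (hz : ∀ μ, |q μ| ≤ π * N) (μ : Fin d) : |η' * q μ| ≤ π := by
  rw [abs_mul, abs_of_pos hη']
  calc η' * |q μ| ≤ N⁻¹ * |q μ| := mul_le_mul_of_nonneg_right hη'N (abs_nonneg _)
    _ ≤ π := by rw [inv_mul_le_iff₀ hN, mul_comm]; exact hz μ

/-- ONE MODE of (4.19) with an extra factor: the first line's mode `Δ·u^η(Q)·Δ^η(Q)⁻¹·e^{iQ·ξ}` times `E(Q)` (King's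
`η⁻¹{exp[iηQ_μ] − 1}`, `|x − y|^{−α}{1 − exp[iQ(y − x)]}`, or their product). [cite: King1986, (4.19) p.672] -/
def fmodeTerm {d : ℕ} (Δ η M : ℝ) (q ξ : Fin d → ℝ) (E : (Fin d → ℝ) → ℂ) : ℂ :=
  modeTerm Δ η M q ξ * E q

/-- The size of a factored mode: `‖T·E‖ = (Δ·Δ^η(Q)⁻¹·‖u^η(Q)‖)·‖E(Q)‖` (`Δ ≥ 0`, `m² ≥ 0`). [cite: King1986, (4.19)–(4.21) p.672] -/
theorem norm_fmodeTerm {d : ℕ} {Δ η M : ℝ} (hΔ : 0 ≤ Δ) (hM : 0 ≤ M) (q ξ : Fin d → ℝ)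
    (E : (Fin d → ℝ) → ℂ) : ‖fmodeTerm Δ η M q ξ E‖ = modeAmp Δ η M q * ‖E q‖ := by
  unfold fmodeTerm
  rw [norm_mul, norm_modeTerm hΔ hM]

/-- **THE FAR ALIASES WITH AN EXTRA FACTOR, termwise** ((4.23) with King's exponent bookkeeping): an alias point at
sup-distance `≥ N` from the origin, an extra factor of size `‖E(Q)‖ ≤ c_E‖Q‖^β`, `0 ≤ Δ ≤ a`, `0 ≤ γ`:
`‖T(Q)E(Q)‖ ≤ a(π/2)^d(π²/4)c_E·N^{−γ}·aliasTerm (β+γ−1) p′ k` — (4.20)×(4.21)×size = `a(π/2)^d(π²/4)c_E·W·‖Q‖^{β−2}` and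
`‖Q‖^{β−2} = ‖Q‖^{−γ}‖Q‖^{β+γ−2} ≤ N^{−γ}‖Q‖^{β+γ−2}`. [cite: King1986, (4.22)–(4.23) p.672] -/
theorem fmodeTerm_far_le {d : ℕ} {η : ℝ} (hη : 0 < η) {M Δ a : ℝ} (hM : 0 ≤ M) (hΔ : 0 ≤ Δ) (hΔa : Δ ≤ a)
    {γ : ℝ} (hγ : 0 ≤ γ) {β : ℝ} {N : ℝ} (hN : 1 ≤ N)
    {p : Fin d → ℝ} (hp : ∀ μ, |p μ| ≤ π) {k : Fin d → ℤ} (hk : k ≠ 0)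
    (hz : ∀ μ, |η * aliasPt p k μ| ≤ π) (hfar : N ≤ ‖aliasPt p k‖) (ξ : Fin d → ℝ)
    {E : (Fin d → ℝ) → ℂ} {cE : ℝ} (hcE : 0 ≤ cE) (hE : ‖E (aliasPt p k)‖ ≤ cE * ‖aliasPt p k‖ ^ β) :
    ‖fmodeTerm Δ η M (aliasPt p k) ξ E‖
      ≤ a * ((π / 2) ^ d * (π ^ 2 / 4)) * cE * N ^ (-γ) * aliasTerm (β + γ - 1) p k := by
  set q := aliasPt p k with hq_def
  have hNpos : 0 < N := lt_of_lt_of_le one_pos hN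
  have hqpos : 0 < ‖q‖ := lt_of_lt_of_le hNpos hfar
  have ha : 0 ≤ a := hΔ.trans hΔa
  have hW : 0 ≤ aliasWeight p k := aliasWeight_nonneg p k
  have h1 := modeAmp_alias_le hη hM hΔ hp hk hz
  -- the trade `‖q‖^{-2}·‖q‖^β = ‖q‖^{-γ}·‖q‖^{β+γ-2} ≤ N^{-γ}‖q‖^{β+γ-2}`
  have htrade : ‖q‖ ^ (-2 : ℝ) * ‖q‖ ^ β ≤ N ^ (-γ) * ‖q‖ ^ (β + γ - 1 - 1) := by
    have hsplit : ‖q‖ ^ (-2 : ℝ) * ‖q‖ ^ β = ‖q‖ ^ (-γ) * ‖q‖ ^ (β + γ - 1 - 1) := by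
      rw [← Real.rpow_add hqpos, ← Real.rpow_add hqpos]; congr 1; ring
    rw [hsplit]
    refine mul_le_mul_of_nonneg_right ?_ (Real.rpow_nonneg hqpos.le _)
    rw [Real.rpow_neg hqpos.le, Real.rpow_neg hNpos.le]
    exact inv_anti₀ (Real.rpow_pos_of_pos hNpos γ) (Real.rpow_le_rpow hNpos.le hfar hγ)
  rw [norm_fmodeTerm hΔ hM]
  unfold aliasTerm
  calc modeAmp Δ η M q * ‖E q‖
      ≤ (Δ * (π ^ 2 / 4 * ‖q‖ ^ (-2 : ℝ)) * ((π / 2) ^ d * aliasWeight p k)) * (cE * ‖q‖ ^ β) :=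
        mul_le_mul h1 hE (norm_nonneg _) (by positivity)
    _ = Δ * ((π / 2) ^ d * (π ^ 2 / 4)) * cE * (‖q‖ ^ (-2 : ℝ) * ‖q‖ ^ β) * aliasWeight p k := by ring
    _ ≤ a * ((π / 2) ^ d * (π ^ 2 / 4)) * cE * (N ^ (-γ) * ‖q‖ ^ (β + γ - 1 - 1)) * aliasWeight p k := by
        gcongr
    _ = a * ((π / 2) ^ d * (π ^ 2 / 4)) * cE * N ^ (-γ) * (‖q‖ ^ (β + γ - 1 - 1) * aliasWeight p k) := by ring

/-- **(4.23) with an extra factor, summed**: over any finite family `Λ` of nonzero aliases at sup-distance `≥ N` from the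
origin and in the zone of `η`, with `‖E(Q)‖ ≤ c_E‖Q‖^β` on the family, `Σ_{k∈Λ}‖T(Q_k)E(Q_k)‖ ≤ a(π/2)^d(π²/4)c_E·
C(d, β+γ−1)·N^{−γ}` for `0 ≤ γ`, `β + γ < 2` — the alias sum (4.22) with `α − 1 = β + γ − 2`. [cite: King1986, (4.22)–(4.23) p.672] -/
theorem sum_fmodeTerm_far_le {d : ℕ} (hd : 0 < d) {η : ℝ} (hη : 0 < η) {M Δ a : ℝ} (hM : 0 ≤ M) (hΔ : 0 ≤ Δ)
    (hΔa : Δ ≤ a) {γ : ℝ} (hγ : 0 ≤ γ) {β : ℝ} (hβγ : β + γ < 2) {N : ℝ} (hN : 1 ≤ N)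
    {p : Fin d → ℝ} (hp : ∀ μ, |p μ| ≤ π) {Λ : Finset (Fin d → ℤ)} (h0 : (0 : Fin d → ℤ) ∉ Λ)
    (hz : ∀ k ∈ Λ, ∀ μ, |η * aliasPt p k μ| ≤ π) (hfar : ∀ k ∈ Λ, N ≤ ‖aliasPt p k‖)
    (ξ : Fin d → ℝ) {E : (Fin d → ℝ) → ℂ} {cE : ℝ} (hcE : 0 ≤ cE)
    (hE : ∀ k ∈ Λ, ‖E (aliasPt p k)‖ ≤ cE * ‖aliasPt p k‖ ^ β) :
    ∑ k ∈ Λ, ‖fmodeTerm Δ η M (aliasPt p k) ξ E‖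
      ≤ a * ((π / 2) ^ d * (π ^ 2 / 4)) * cE * N ^ (-γ) * aliasConst d (β + γ - 1) := by
  have ha : 0 ≤ a := hΔ.trans hΔa
  have hNpos : 0 < N := lt_of_lt_of_le one_pos hN
  calc ∑ k ∈ Λ, ‖fmodeTerm Δ η M (aliasPt p k) ξ E‖
      ≤ ∑ k ∈ Λ, a * ((π / 2) ^ d * (π ^ 2 / 4)) * cE * N ^ (-γ) * aliasTerm (β + γ - 1) p k := by
        refine Finset.sum_le_sum fun k hk => ?_
        have hk0 : k ≠ 0 := fun h => h0 (h ▸ hk)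
        exact fmodeTerm_far_le hη hM hΔ hΔa hγ hN hp hk0 (hz k hk) (hfar k hk) ξ hcE (hE k hk)
    _ = a * ((π / 2) ^ d * (π ^ 2 / 4)) * cE * N ^ (-γ) * ∑ k ∈ Λ, aliasTerm (β + γ - 1) p k := by
        rw [Finset.mul_sum]
    _ ≤ a * ((π / 2) ^ d * (π ^ 2 / 4)) * cE * N ^ (-γ) * aliasConst d (β + γ - 1) := by
        refine mul_le_mul_of_nonneg_left (alias_sum_le_of_subset hd (by linarith) hp h0) ?_
        exact mul_nonneg (mul_nonneg (mul_nonneg ha (by positivity)) hcE) (Real.rpow_nonneg (le_of_lt hNpos) _)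

/-! ## §2 The near aliases `m = 0`, `l ≠ 0` -/

/-- The rate constant of one near alias with an extra factor: `nearRateConst·c_E` (the first line's four replacements
times the size of the factor) `+ a(π/2)^d(π²/4)·r_E` (the factor's own replacement against (4.20)–(4.21)).
[cite: King1986, (4.24)–(4.31) p.673] -/
def fnearRateConst (aA θ : ℝ) (d : ℕ) (γ cE rE : ℝ) : ℝ :=
  nearRateConst aA θ d γ * cE + aA * ((π / 2) ^ d * (π ^ 2 / 4)) * rE

/-- The position constant of one near alias with an extra factor: `nearPosConst·c_E + a(π/2)^d(π²/4)·s_E`.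
[cite: King1986, (4.24)–(4.31) p.673] -/
def fnearPosConst (aA : ℝ) (d : ℕ) (γ cE sE : ℝ) : ℝ :=
  nearPosConst aA d γ * cE + aA * ((π / 2) ^ d * (π ^ 2 / 4)) * sE

/-- For a nonzero alias the exponents add: `aliasTerm (γ−1) p j · ‖q‖^β = aliasTerm (β+γ−1) p j`. [folklore] -/
private theorem aliasTerm_mul_rpow {d : ℕ} {γ β : ℝ} {p : Fin d → ℝ} (hp : ∀ μ, |p μ| ≤ π) {j : Fin d → ℤ}
    (hj : j ≠ 0) : aliasTerm (γ - 1) p j * ‖aliasPt p j‖ ^ β = aliasTerm (β + γ - 1) p j := by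
  have hqpos : 0 < ‖aliasPt p j‖ := lt_of_lt_of_le one_pos (one_le_norm_aliasPt hp hj)
  unfold aliasTerm
  rw [mul_right_comm, ← Real.rpow_add hqpos]
  congr 2; ring

/-- **THE NEAR ALIASES WITH AN EXTRA FACTOR, termwise** (p. 673 «every term in (4.19) for m = 0 can be replaced»): for a
nonzero alias `q = p′ + 2πj` in the zone `|q_ν| ≤ πN`, `0 < η′ ≤ η = N⁻¹`, `0 ≤ Δ_A ≤ a`, `|Δ_B − Δ_A| ≤ θN⁻²Δ_A`, positions
`|ξ′_ν − ξ_ν| ≤ δ`, and factors with `‖E_B(q)‖ ≤ c_E‖q‖^β`, `‖E_B(q) − E_A(q)‖ ≤ (r_EN^{−γ} + s_Eδ^γ)‖q‖^{β+γ}`: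
`‖T_BE_B − T_AE_A‖ ≤ (K₁^E N^{−γ} + K₂^E δ^γ)·aliasTerm (β+γ−1) p′ j`, `0 ≤ γ ≤ 1` — `(T_B − T_A)E_B` by the first line's
`norm_modeTerm_sub_near_le`, `T_A(E_B − E_A)` by `modeAmp_alias_le`. [cite: King1986, (4.24)–(4.31) p.673] -/
theorem norm_fmodeTerm_sub_near_le {d : ℕ} {N : ℝ} (hN : 1 ≤ N) {η' : ℝ} (hη' : 0 < η') (hη'N : η' ≤ N⁻¹)
    {M : ℝ} (hM : 0 ≤ M) {γ : ℝ} (hγ0 : 0 ≤ γ) (hγ1 : γ ≤ 1) {β : ℝ}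
    {ΔA ΔB aA θ : ℝ} (hΔA : 0 ≤ ΔA) (hΔAa : ΔA ≤ aA) (hθ : 0 ≤ θ)
    (h43 : |ΔB - ΔA| ≤ θ * (N ^ 2)⁻¹ * ΔA)
    {p : Fin d → ℝ} (hp : ∀ μ, |p μ| ≤ π) {j : Fin d → ℤ} (hj : j ≠ 0)
    (hz : ∀ μ, |aliasPt p j μ| ≤ π * N)
    {ξ ξ' : Fin d → ℝ} {δ : ℝ} (hδ : 0 ≤ δ) (hξ : ∀ μ, |ξ' μ - ξ μ| ≤ δ)
    {EA EB : (Fin d → ℝ) → ℂ} {cE rE sE : ℝ} (hrE : 0 ≤ rE) (hsE : 0 ≤ sE)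
    (hEB : ‖EB (aliasPt p j)‖ ≤ cE * ‖aliasPt p j‖ ^ β)
    (hEd : ‖EB (aliasPt p j) - EA (aliasPt p j)‖
      ≤ (rE * N ^ (-γ) + sE * δ ^ γ) * ‖aliasPt p j‖ ^ (β + γ)) :
    ‖fmodeTerm ΔB η' M (aliasPt p j) ξ' EB - fmodeTerm ΔA N⁻¹ M (aliasPt p j) ξ EA‖
      ≤ (fnearRateConst aA θ d γ cE rE * N ^ (-γ) + fnearPosConst aA d γ cE sE * δ ^ γ)
        * aliasTerm (β + γ - 1) p j := by
  set q := aliasPt p j with hq_def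
  set W := aliasWeight p j with hW_def
  set TA := modeTerm ΔA N⁻¹ M q ξ with hTA_def
  set TB := modeTerm ΔB η' M q ξ' with hTB_def
  have hNpos : 0 < N := lt_of_lt_of_le one_pos hN
  have hη : 0 < N⁻¹ := inv_pos.mpr hNpos
  have hq1 : 1 ≤ ‖q‖ := one_le_norm_aliasPt hp hj
  have hqpos : 0 < ‖q‖ := lt_of_lt_of_le one_pos hq1
  have hzA : ∀ ν, |N⁻¹ * q ν| ≤ π := zone_of_le'' hNpos hη le_rfl hz
  have haA : 0 ≤ aA := hΔA.trans hΔAa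
  have hW0 : 0 ≤ W := aliasWeight_nonneg p j
  have hNγ : 0 ≤ N ^ (-γ) := Real.rpow_nonneg hNpos.le _
  have hδγ : 0 ≤ δ ^ γ := Real.rpow_nonneg hδ _
  -- the factor bounds
  have h1 : ‖TB - TA‖ ≤ (nearRateConst aA θ d γ * N ^ (-γ) + nearPosConst aA d γ * δ ^ γ)
      * aliasTerm (γ - 1) p j :=
    norm_modeTerm_sub_near_le hN hη' hη'N hM hγ0 hγ1 hΔA hΔAa hθ h43 hp hj hz hδ hξ
  have h3 : ‖TA‖ ≤ aA * (π ^ 2 / 4 * ‖q‖ ^ (-2 : ℝ)) * ((π / 2) ^ d * W) := by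
    rw [hTA_def, norm_modeTerm hΔA hM]
    exact (modeAmp_alias_le hη hM hΔA hp hj hzA).trans
      (mul_le_mul_of_nonneg_right (mul_le_mul_of_nonneg_right hΔAa (by positivity)) (by positivity))
  have hK1 : 0 ≤ nearRateConst aA θ d γ := by unfold nearRateConst; positivity
  have hK2 : 0 ≤ nearPosConst aA d γ := by unfold nearPosConst; positivity
  have hKK : 0 ≤ nearRateConst aA θ d γ * N ^ (-γ) + nearPosConst aA d γ * δ ^ γ := by positivity
  have hAT : 0 ≤ aliasTerm (γ - 1) p j := aliasTerm_nonneg _ p j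
  have hRS : 0 ≤ rE * N ^ (-γ) + sE * δ ^ γ := by positivity
  -- telescoping
  have hid : fmodeTerm ΔB η' M q ξ' EB - fmodeTerm ΔA N⁻¹ M q ξ EA = (TB - TA) * EB q + TA * (EB q - EA q) := by
    simp only [fmodeTerm, hTA_def, hTB_def]; ring
  rw [hid]
  have hT1 : ‖(TB - TA) * EB q‖
      ≤ (nearRateConst aA θ d γ * N ^ (-γ) + nearPosConst aA d γ * δ ^ γ) * cE * aliasTerm (β + γ - 1) p j := by
    rw [norm_mul]
    calc ‖TB - TA‖ * ‖EB q‖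
        ≤ ((nearRateConst aA θ d γ * N ^ (-γ) + nearPosConst aA d γ * δ ^ γ) * aliasTerm (γ - 1) p j)
            * (cE * ‖q‖ ^ β) := mul_le_mul h1 hEB (norm_nonneg _) (mul_nonneg hKK hAT)
      _ = (nearRateConst aA θ d γ * N ^ (-γ) + nearPosConst aA d γ * δ ^ γ) * cE
            * (aliasTerm (γ - 1) p j * ‖q‖ ^ β) := by ring
      _ = _ := by rw [aliasTerm_mul_rpow hp hj]
  have hT2 : ‖TA * (EB q - EA q)‖
      ≤ aA * ((π / 2) ^ d * (π ^ 2 / 4)) * (rE * N ^ (-γ) + sE * δ ^ γ) * aliasTerm (β + γ - 1) p j := by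
    rw [norm_mul]
    have hpow : ‖q‖ ^ (-2 : ℝ) * ‖q‖ ^ (β + γ) = ‖q‖ ^ (β + γ - 1 - 1) := by
      rw [← Real.rpow_add hqpos]; congr 1; ring
    calc ‖TA‖ * ‖EB q - EA q‖
        ≤ (aA * (π ^ 2 / 4 * ‖q‖ ^ (-2 : ℝ)) * ((π / 2) ^ d * W)) * ((rE * N ^ (-γ) + sE * δ ^ γ) * ‖q‖ ^ (β + γ)) :=
          mul_le_mul h3 hEd (norm_nonneg _) (by positivity)
      _ = aA * ((π / 2) ^ d * (π ^ 2 / 4)) * (rE * N ^ (-γ) + sE * δ ^ γ)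
            * ((‖q‖ ^ (-2 : ℝ) * ‖q‖ ^ (β + γ)) * W) := by ring
      _ = aA * ((π / 2) ^ d * (π ^ 2 / 4)) * (rE * N ^ (-γ) + sE * δ ^ γ) * aliasTerm (β + γ - 1) p j := by
          rw [hpow]; rfl
  calc ‖(TB - TA) * EB q + TA * (EB q - EA q)‖ ≤ ‖(TB - TA) * EB q‖ + ‖TA * (EB q - EA q)‖ := norm_add_le _ _
    _ ≤ (nearRateConst aA θ d γ * N ^ (-γ) + nearPosConst aA d γ * δ ^ γ) * cE * aliasTerm (β + γ - 1) p j
        + aA * ((π / 2) ^ d * (π ^ 2 / 4)) * (rE * N ^ (-γ) + sE * δ ^ γ) * aliasTerm (β + γ - 1) p j :=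
        add_le_add hT1 hT2
    _ = (fnearRateConst aA θ d γ cE rE * N ^ (-γ) + fnearPosConst aA d γ cE sE * δ ^ γ)
        * aliasTerm (β + γ - 1) p j := by
        unfold fnearRateConst fnearPosConst; ring

/-! ## §3 The central alias `l = 0` -/

/-- Rate constant of the central alias with an extra factor: `centralRateConst·c_E·π^β + K(π²/4)(π/2)^d·r_E·π^{β+γ}`
(`‖p′‖ ≤ π`). [cite: King1986, (4.24)–(4.31) p.673] -/
def fcentralRateConst (aA θ K : ℝ) (d : ℕ) (γ β cE rE : ℝ) : ℝ :=
  centralRateConst aA θ K d γ * cE * π ^ β + K * (π ^ 2 / 4) * (π / 2) ^ d * rE * π ^ (β + γ)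

/-- Position constant of the central alias with an extra factor: `centralPosConst·c_E·π^β + K(π²/4)(π/2)^d·s_E·π^{β+γ}`.
[cite: King1986, (4.24) p.673] -/
def fcentralPosConst (K : ℝ) (d : ℕ) (γ β cE sE : ℝ) : ℝ :=
  centralPosConst K d γ * cE * π ^ β + K * (π ^ 2 / 4) * (π / 2) ^ d * sE * π ^ (β + γ)

/-- The sup norm of the reduced momentum is `≤ π`. [folklore] -/
private theorem norm_le_pi_of_abs_le {d : ℕ} {p : Fin d → ℝ} (hp : ∀ μ, |p μ| ≤ π) : ‖p‖ ≤ π :=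
  (pi_norm_le_iff_of_nonneg Real.pi_pos.le).mpr fun μ => by rw [Real.norm_eq_abs]; exact hp μ

/-- **THE CENTRAL ALIAS WITH AN EXTRA FACTOR** (`q = p′`, `|p′_μ| ≤ π`): with `Δ_A ≤ K·Δ^η(p′)` ((4.21) at `l = 0`) and
the factor bounds at `p′` (`0 ≤ β`), `‖T_BE_B − T_AE_A‖ ≤ K^E_{c1}·N^{−γ} + K^E_{c2}·δ^γ` — the first line's central
bound (`norm_modeTerm_sub_central_le`) times `c_Eπ^β`, plus `‖T_A‖ ≤ K(π²/4)(π/2)^d` (`central_ratio_le`,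
`norm_uWeight_le`) times the factor replacement at `‖p′‖ ≤ π`. [cite: King1986, (4.24)–(4.31) p.673] -/
theorem norm_fmodeTerm_sub_central_le {d : ℕ} {N : ℝ} (hN : 1 ≤ N) {η' : ℝ} (hη' : 0 < η') (hη'N : η' ≤ N⁻¹)
    {M : ℝ} (hM : 0 ≤ M) {γ : ℝ} (hγ0 : 0 ≤ γ) (hγ1 : γ ≤ 1) {β : ℝ} (hβ : 0 ≤ β)
    {ΔA ΔB aA θ K : ℝ} (hΔA : 0 ≤ ΔA) (hΔAa : ΔA ≤ aA) (hθ : 0 ≤ θ) (hK : 0 ≤ K)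
    (h43 : |ΔB - ΔA| ≤ θ * (N ^ 2)⁻¹ * ΔA)
    {p : Fin d → ℝ} (hp : ∀ μ, |p μ| ≤ π) (hcen : ΔA ≤ K * latticeSymbol N⁻¹ M p)
    {ξ ξ' : Fin d → ℝ} {δ : ℝ} (hδ : 0 ≤ δ) (hξ : ∀ μ, |ξ' μ - ξ μ| ≤ δ)
    {EA EB : (Fin d → ℝ) → ℂ} {cE rE sE : ℝ} (hcE : 0 ≤ cE) (hrE : 0 ≤ rE) (hsE : 0 ≤ sE)
    (hEB : ‖EB p‖ ≤ cE * ‖p‖ ^ β)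
    (hEd : ‖EB p - EA p‖ ≤ (rE * N ^ (-γ) + sE * δ ^ γ) * ‖p‖ ^ (β + γ)) :
    ‖fmodeTerm ΔB η' M p ξ' EB - fmodeTerm ΔA N⁻¹ M p ξ EA‖
      ≤ fcentralRateConst aA θ K d γ β cE rE * N ^ (-γ) + fcentralPosConst K d γ β cE sE * δ ^ γ := by
  set TA := modeTerm ΔA N⁻¹ M p ξ with hTA_def
  set TB := modeTerm ΔB η' M p ξ' with hTB_def
  have hNpos : 0 < N := lt_of_lt_of_le one_pos hN
  have hη : 0 < N⁻¹ := inv_pos.mpr hNpos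
  have hz : ∀ ν, |p ν| ≤ π * N := fun ν => (hp ν).trans (by nlinarith [Real.pi_pos])
  have hzA : ∀ ν, |N⁻¹ * p ν| ≤ π := zone_of_le'' hNpos hη le_rfl hz
  have haA : 0 ≤ aA := hΔA.trans hΔAa
  have hNγ : 0 ≤ N ^ (-γ) := Real.rpow_nonneg hNpos.le _
  have hδγ : 0 ≤ δ ^ γ := Real.rpow_nonneg hδ _
  have hpπ : ‖p‖ ≤ π := norm_le_pi_of_abs_le hp
  have hpβ : ‖p‖ ^ β ≤ π ^ β := Real.rpow_le_rpow (norm_nonneg _) hpπ hβ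
  have hpβγ : ‖p‖ ^ (β + γ) ≤ π ^ (β + γ) := Real.rpow_le_rpow (norm_nonneg _) hpπ (by linarith)
  -- the factor bounds
  have h1 : ‖TB - TA‖ ≤ centralRateConst aA θ K d γ * N ^ (-γ) + centralPosConst K d γ * δ ^ γ :=
    norm_modeTerm_sub_central_le hN hη' hη'N hM hγ0 hγ1 hΔA hΔAa hθ hK h43 hp hcen hδ hξ
  have h2 : ‖EB p‖ ≤ cE * π ^ β := hEB.trans (mul_le_mul_of_nonneg_left hpβ hcE)
  have h3 : ‖TA‖ ≤ K * (π ^ 2 / 4) * (π / 2) ^ d := by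
    rw [hTA_def, norm_modeTerm hΔA hM]
    unfold modeAmp
    exact mul_le_mul (central_ratio_le hη.ne' hη.ne' hM hK hzA hcen) (norm_uWeight_le hη hzA)
      (norm_nonneg _) (by positivity)
  have hRS : 0 ≤ rE * N ^ (-γ) + sE * δ ^ γ := by positivity
  have h4 : ‖EB p - EA p‖ ≤ (rE * N ^ (-γ) + sE * δ ^ γ) * π ^ (β + γ) :=
    hEd.trans (mul_le_mul_of_nonneg_left hpβγ hRS)
  have hc1 : 0 ≤ centralRateConst aA θ K d γ := by unfold centralRateConst; positivity
  have hc2 : 0 ≤ centralPosConst K d γ := by unfold centralPosConst; positivity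
  -- telescoping
  have hid : fmodeTerm ΔB η' M p ξ' EB - fmodeTerm ΔA N⁻¹ M p ξ EA = (TB - TA) * EB p + TA * (EB p - EA p) := by
    simp only [fmodeTerm, hTA_def, hTB_def]; ring
  rw [hid]
  have hT1 : ‖(TB - TA) * EB p‖
      ≤ (centralRateConst aA θ K d γ * N ^ (-γ) + centralPosConst K d γ * δ ^ γ) * (cE * π ^ β) := by
    rw [norm_mul]; exact mul_le_mul h1 h2 (norm_nonneg _) (by positivity)
  have hT2 : ‖TA * (EB p - EA p)‖
      ≤ (K * (π ^ 2 / 4) * (π / 2) ^ d) * ((rE * N ^ (-γ) + sE * δ ^ γ) * π ^ (β + γ)) := by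
    rw [norm_mul]; exact mul_le_mul h3 h4 (norm_nonneg _) (by positivity)
  calc ‖(TB - TA) * EB p + TA * (EB p - EA p)‖ ≤ ‖(TB - TA) * EB p‖ + ‖TA * (EB p - EA p)‖ := norm_add_le _ _
    _ ≤ (centralRateConst aA θ K d γ * N ^ (-γ) + centralPosConst K d γ * δ ^ γ) * (cE * π ^ β)
        + (K * (π ^ 2 / 4) * (π / 2) ^ d) * ((rE * N ^ (-γ) + sE * δ ^ γ) * π ^ (β + γ)) := add_le_add hT1 hT2
    _ = fcentralRateConst aA θ K d γ β cE rE * N ^ (-γ) + fcentralPosConst K d γ β cE sE * δ ^ γ := by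
        unfold fcentralRateConst fcentralPosConst; ring

/-! ## §4 The assembled bound and King's own symbols -/

/-- Rate constant of the assembled factored bound: far part + near part × `C(d, β+γ−1)` + central part.
[cite: King1986, Prop. 3.8 p.664 with (4.22)–(4.31) pp.672–673] -/
def fprop38RateConst (aA aB θ K : ℝ) (d : ℕ) (γ β cE rE : ℝ) : ℝ :=
  aB * ((π / 2) ^ d * (π ^ 2 / 4)) * cE * aliasConst d (β + γ - 1)
    + fnearRateConst aA θ d γ cE rE * aliasConst d (β + γ - 1) + fcentralRateConst aA θ K d γ β cE rE

/-- Position constant of the assembled factored bound: near part × `C(d, β+γ−1)` + central part.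
[cite: King1986, Prop. 3.8 p.664 with (4.24) p.673] -/
def fprop38PosConst (aA K : ℝ) (d : ℕ) (γ β cE sE : ℝ) : ℝ :=
  fnearPosConst aA d γ cE sE * aliasConst d (β + γ - 1) + fcentralPosConst K d γ β cE sE

/-- `p′ + 2π·0 = p′`. [folklore] -/
private theorem aliasPt_zero'' {d : ℕ} (p : Fin d → ℝ) : aliasPt p 0 = p := by
  funext μ; simp [aliasPt]

/-- **KING'S PROPOSITION 3.8, MOMENTUM-SPACE CORE WITH AN EXTRA FACTOR.**  Fix the reduced momentum `p′` (`|p′_ν| ≤ π`),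
`N` (`η = N⁻¹`), `R` (`η′ = (RN)⁻¹`), digit sets `J` (`2|j_ν| < N`), `B` (`2|b_ν| < R`), effective symbols `0 ≤ Δ_A ≤ a_A`,
`0 ≤ Δ_B ≤ a_B` with `|Δ_B − Δ_A| ≤ θN⁻²Δ_A`, `Δ_A ≤ KΔ^η(p′)`, positions `|ξ′_ν − ξ_ν| ≤ δ`, and two factor families with
`‖E_B(Q)‖ ≤ c_E‖Q‖^β` and `‖E_B(Q) − E_A(Q)‖ ≤ (r_EN^{−γ} + s_Eδ^γ)‖Q‖^{β+γ}` at every alias momentum `Q = p′ + 2πw`.  Then for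
`0 ≤ γ ≤ 1`, `0 ≤ β`, `β + γ < 2`, `d ≥ 1`: `Σ_{j∈J}Σ_{b∈B∖0}‖T_B(j+Nb)E_B‖ + Σ_{j∈J}‖T_B(j)E_B − T_A(j)E_A‖ ≤ C₁^E·N^{−γ} +
C₂^E·δ^γ` — King's bookkeeping «|(4.19); m ≠ 0| ≦ CL^{−γk} for α + γ < 1» and «every term in (4.19) for m = 0 can be
replaced», with the momentum powers carried by the extra factor made a parameter. [cite: King1986, Prop. 3.8 (3.71) p.664; (4.19)–(4.31) pp.672–674] -/
theorem alias_sums_two_spacing_factor_le {d : ℕ} (hd : 0 < d) {N R : ℕ} (hN : 1 ≤ N) (hR : 1 ≤ R)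
    {M : ℝ} (hM : 0 ≤ M) {γ : ℝ} (hγ0 : 0 ≤ γ) (hγ1 : γ ≤ 1) {β : ℝ} (hβ : 0 ≤ β) (hβγ : β + γ < 2)
    {ΔA ΔB aA aB θ K : ℝ} (hΔA : 0 ≤ ΔA) (hΔAa : ΔA ≤ aA) (hΔB : 0 ≤ ΔB) (hΔBa : ΔB ≤ aB)
    (hθ : 0 ≤ θ) (hK : 0 ≤ K) (h43 : |ΔB - ΔA| ≤ θ * ((N : ℝ) ^ 2)⁻¹ * ΔA)
    {p : Fin d → ℝ} (hp : ∀ μ, |p μ| ≤ π) (hcen : ΔA ≤ K * latticeSymbol (N : ℝ)⁻¹ M p)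
    {J B : Finset (Fin d → ℤ)} (hJ : ∀ j ∈ J, ∀ μ, 2 * |j μ| < (N : ℤ))
    (hB : ∀ b ∈ B, ∀ μ, 2 * |b μ| < (R : ℤ))
    {ξ ξ' : Fin d → ℝ} {δ : ℝ} (hδ : 0 ≤ δ) (hξ : ∀ μ, |ξ' μ - ξ μ| ≤ δ)
    {EA EB : (Fin d → ℝ) → ℂ} {cE rE sE : ℝ} (hcE : 0 ≤ cE) (hrE : 0 ≤ rE) (hsE : 0 ≤ sE)
    (hEB : ∀ w : Fin d → ℤ, ‖EB (aliasPt p w)‖ ≤ cE * ‖aliasPt p w‖ ^ β)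
    (hEd : ∀ w : Fin d → ℤ, ‖EB (aliasPt p w) - EA (aliasPt p w)‖
      ≤ (rE * (N : ℝ) ^ (-γ) + sE * δ ^ γ) * ‖aliasPt p w‖ ^ (β + γ)) :
    (∑ j ∈ J, ∑ b ∈ B.erase 0, ‖fmodeTerm ΔB ((R : ℝ) * N)⁻¹ M (aliasPt p (j + (N : ℤ) • b)) ξ' EB‖)
      + ∑ j ∈ J, ‖fmodeTerm ΔB ((R : ℝ) * N)⁻¹ M (aliasPt p j) ξ' EB - fmodeTerm ΔA (N : ℝ)⁻¹ M (aliasPt p j) ξ EA‖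
      ≤ fprop38RateConst aA aB θ K d γ β cE rE * (N : ℝ) ^ (-γ) + fprop38PosConst aA K d γ β cE sE * δ ^ γ := by
  have hNr : (1 : ℝ) ≤ N := by exact_mod_cast hN
  have hRr : (1 : ℝ) ≤ R := by exact_mod_cast hR
  have hNpos : (0 : ℝ) < N := by linarith
  have hηB : 0 < ((R : ℝ) * N)⁻¹ := by positivity
  have hηBA : ((R : ℝ) * N)⁻¹ ≤ (N : ℝ)⁻¹ := by
    rw [mul_inv]; exact mul_le_of_le_one_left (inv_nonneg.mpr hNpos.le) (inv_le_one_of_one_le₀ hRr)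
  have hNγ : 0 ≤ (N : ℝ) ^ (-γ) := Real.rpow_nonneg hNpos.le _
  have hδγ : 0 ≤ δ ^ γ := Real.rpow_nonneg hδ _
  have haA : 0 ≤ aA := hΔA.trans hΔAa
  have haB : 0 ≤ aB := hΔB.trans hΔBa
  have hAC : 0 ≤ aliasConst d (β + γ - 1) :=
    (Finset.sum_nonneg fun k _ => aliasTerm_nonneg (β + γ - 1) p k).trans
      (alias_sum_le_of_subset hd (by linarith) hp (Finset.notMem_empty 0))
  -- FAR PART
  set Λ : Finset (Fin d → ℤ) := (J ×ˢ B.erase 0).image (fun jb => jb.1 + (N : ℤ) • jb.2) with hΛ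
  have hinj : Set.InjOn (fun jb : (Fin d → ℤ) × (Fin d → ℤ) => jb.1 + (N : ℤ) • jb.2) ↑(J ×ˢ B.erase 0) := by
    rintro ⟨j, b⟩ hjb ⟨j', b'⟩ hjb' h
    simp only [Finset.coe_product, Set.mem_prod, Finset.mem_coe] at hjb hjb'
    obtain ⟨h1, h2⟩ := digits_injective_pi (hJ j hjb.1) (hJ j' hjb'.1) h
    exact Prod.ext h1 h2
  have hfar : ∑ j ∈ J, ∑ b ∈ B.erase 0, ‖fmodeTerm ΔB ((R : ℝ) * N)⁻¹ M (aliasPt p (j + (N : ℤ) • b)) ξ' EB‖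
      ≤ aB * ((π / 2) ^ d * (π ^ 2 / 4)) * cE * (N : ℝ) ^ (-γ) * aliasConst d (β + γ - 1) := by
    rw [← Finset.sum_product (s := J) (t := B.erase 0)
      (f := fun jb => ‖fmodeTerm ΔB ((R : ℝ) * N)⁻¹ M (aliasPt p (jb.1 + (N : ℤ) • jb.2)) ξ' EB‖)]
    have himg : ∑ jb ∈ J ×ˢ B.erase 0, ‖fmodeTerm ΔB ((R : ℝ) * N)⁻¹ M (aliasPt p (jb.1 + (N : ℤ) • jb.2)) ξ' EB‖
        = ∑ k ∈ Λ, ‖fmodeTerm ΔB ((R : ℝ) * N)⁻¹ M (aliasPt p k) ξ' EB‖ :=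
      (Finset.sum_image (f := fun k => ‖fmodeTerm ΔB ((R : ℝ) * N)⁻¹ M (aliasPt p k) ξ' EB‖) hinj).symm
    rw [himg]
    refine sum_fmodeTerm_far_le hd hηB hM hΔB hΔBa hγ0 hβγ hNr hp ?_ ?_ ?_ ξ' hcE (fun k _ => hEB k)
    · intro h0
      rw [Finset.mem_image] at h0
      obtain ⟨⟨j, b⟩, hjb, hk⟩ := h0
      rw [Finset.mem_product, Finset.mem_erase] at hjb
      exact combo_ne_zero (hJ j hjb.1) hjb.2.1 hk
    · intro k hk ν
      rw [Finset.mem_image] at hk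
      obtain ⟨⟨j, b⟩, hjb, rfl⟩ := hk
      rw [Finset.mem_product, Finset.mem_erase] at hjb
      exact zone_of_le'' (mul_pos (by linarith) hNpos) hηB le_rfl
        (zoneB_of_digits hp (hJ j hjb.1) (hB b hjb.2.2)) ν
    · intro k hk
      rw [Finset.mem_image] at hk
      obtain ⟨⟨j, b⟩, hjb, rfl⟩ := hk
      rw [Finset.mem_product, Finset.mem_erase] at hjb
      exact far_of_digits hp (hJ j hjb.1) hjb.2.1
  -- NEAR PART (j ≠ 0) and CENTRAL PART
  set g : (Fin d → ℤ) → ℝ := fun j =>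
    ‖fmodeTerm ΔB ((R : ℝ) * N)⁻¹ M (aliasPt p j) ξ' EB - fmodeTerm ΔA (N : ℝ)⁻¹ M (aliasPt p j) ξ EA‖ with hg
  have hg0 : ∀ j, 0 ≤ g j := fun j => norm_nonneg _
  have hK1 : 0 ≤ fnearRateConst aA θ d γ cE rE := by unfold fnearRateConst nearRateConst; positivity
  have hK2 : 0 ≤ fnearPosConst aA d γ cE sE := by unfold fnearPosConst nearPosConst; positivity
  have hnear : ∑ j ∈ J.erase 0, g j
      ≤ (fnearRateConst aA θ d γ cE rE * (N : ℝ) ^ (-γ) + fnearPosConst aA d γ cE sE * δ ^ γ)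
        * aliasConst d (β + γ - 1) := by
    calc ∑ j ∈ J.erase 0, g j
        ≤ ∑ j ∈ J.erase 0, (fnearRateConst aA θ d γ cE rE * (N : ℝ) ^ (-γ) + fnearPosConst aA d γ cE sE * δ ^ γ)
            * aliasTerm (β + γ - 1) p j := by
          refine Finset.sum_le_sum fun j hj => ?_
          rw [Finset.mem_erase] at hj
          exact norm_fmodeTerm_sub_near_le hNr hηB hηBA hM hγ0 hγ1 hΔA hΔAa hθ h43 hp hj.1
            (zoneA_of_digit hp (hJ j hj.2)) hδ hξ hrE hsE (hEB j) (hEd j)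
      _ = (fnearRateConst aA θ d γ cE rE * (N : ℝ) ^ (-γ) + fnearPosConst aA d γ cE sE * δ ^ γ)
            * ∑ j ∈ J.erase 0, aliasTerm (β + γ - 1) p j := by rw [Finset.mul_sum]
      _ ≤ _ := by
          refine mul_le_mul_of_nonneg_left
            (alias_sum_le_of_subset hd (by linarith) hp (Finset.notMem_erase 0 J)) ?_
          positivity
  have hcentral : g 0 ≤ fcentralRateConst aA θ K d γ β cE rE * (N : ℝ) ^ (-γ)
      + fcentralPosConst K d γ β cE sE * δ ^ γ := by
    have hEB0 := hEB 0
    have hEd0 := hEd 0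
    rw [aliasPt_zero''] at hEB0 hEd0
    simp only [hg, aliasPt_zero'']
    exact norm_fmodeTerm_sub_central_le hNr hηB hηBA hM hγ0 hγ1 hβ hΔA hΔAa hθ hK h43 hp hcen hδ hξ hcE hrE hsE
      hEB0 hEd0
  have hsplit : ∑ j ∈ J, g j ≤ g 0 + ∑ j ∈ J.erase 0, g j := by
    by_cases h0 : (0 : Fin d → ℤ) ∈ J
    · rw [Finset.add_sum_erase J g h0]
    · rw [Finset.erase_eq_of_notMem h0]; linarith [hg0 0]
  -- ASSEMBLY
  calc (∑ j ∈ J, ∑ b ∈ B.erase 0, ‖fmodeTerm ΔB ((R : ℝ) * N)⁻¹ M (aliasPt p (j + (N : ℤ) • b)) ξ' EB‖)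
        + ∑ j ∈ J, g j
      ≤ aB * ((π / 2) ^ d * (π ^ 2 / 4)) * cE * (N : ℝ) ^ (-γ) * aliasConst d (β + γ - 1)
        + ((fcentralRateConst aA θ K d γ β cE rE * (N : ℝ) ^ (-γ) + fcentralPosConst K d γ β cE sE * δ ^ γ)
          + (fnearRateConst aA θ d γ cE rE * (N : ℝ) ^ (-γ) + fnearPosConst aA d γ cE sE * δ ^ γ)
            * aliasConst d (β + γ - 1)) :=
        add_le_add hfar (hsplit.trans (add_le_add hcentral hnear))
    _ = fprop38RateConst aA aB θ K d γ β cE rE * (N : ℝ) ^ (-γ) + fprop38PosConst aA K d γ β cE sE * δ ^ γ := by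
        simp only [fprop38RateConst, fprop38PosConst]; ring

section KingSymbols

open Literature.MathematicalPhysics.QuantumFieldTheory.Balaban1983to89

/-- **PROPOSITION 3.8, MOMENTUM-SPACE CORE WITH AN EXTRA FACTOR, FOR KING'S SYMBOLS.**  With `Δ_A = Δ^{(k)}(p′)`,
`Δ_B = Δ^{(k+n)}(p′)` ((4.5), `DeltaEff` with King's `a_k`, `a_{k+n}`), mass `m² > 0`, `L ≥ 2`, `k, n ≥ 1`, and factor
families `E_A, E_B` with `‖E_B(Q)‖ ≤ c_E‖Q‖^β`, `‖E_B(Q) − E_A(Q)‖ ≤ (r_EL^{−γk} + s_Eδ^γ)‖Q‖^{β+γ}` at the alias momenta: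
the alias sums of the two-spacing difference of the factored mode families (digits `2|j_ν| < L^k`, `2|b_ν| < L^n`,
`|x′_ν − x_ν| ≤ δ`) are `≤ C₁^E·(L^k)^{−γ} + C₂^E·δ^γ` for `0 ≤ γ ≤ 1`, `0 ≤ β`, `β + γ < 2`, uniformly in `p′ ∈ [−π,π]^d`, the
mass and `n`; `C₁^E = fprop38RateConst a a θ (π²/4)^d d γ β c_E r_E`, `C₂^E = fprop38PosConst a (π²/4)^d d γ β c_E s_E`,
`θ = lemma43Const a L k n`. [cite: King1986, Prop. 3.8 (3.71) p.664; (4.19)–(4.31) pp.672–674] -/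
theorem king_prop38_factor_aliasSums {d : ℕ} (hd : 0 < d) {a : ℝ} (ha : 0 < a) {L k n : ℕ} (hL : 2 ≤ L)
    (hk : 1 ≤ k) (hn : 1 ≤ n) {M : ℝ} (hM : 0 < M) {γ : ℝ} (hγ0 : 0 ≤ γ) (hγ1 : γ ≤ 1) {β : ℝ} (hβ : 0 ≤ β)
    (hβγ : β + γ < 2)
    {p : Fin d → ℝ} (hp : ∀ μ, |p μ| ≤ π)
    {J B : Finset (Fin d → ℤ)} (hJ : ∀ j ∈ J, ∀ μ, 2 * |j μ| < ((L ^ k : ℕ) : ℤ))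
    (hB : ∀ b ∈ B, ∀ μ, 2 * |b μ| < ((L ^ n : ℕ) : ℤ))
    {ξ ξ' : Fin d → ℝ} {δ : ℝ} (hδ : 0 ≤ δ) (hξ : ∀ μ, |ξ' μ - ξ μ| ≤ δ)
    {EA EB : (Fin d → ℝ) → ℂ} {cE rE sE : ℝ} (hcE : 0 ≤ cE) (hrE : 0 ≤ rE) (hsE : 0 ≤ sE)
    (hEB : ∀ w : Fin d → ℤ, ‖EB (aliasPt p w)‖ ≤ cE * ‖aliasPt p w‖ ^ β)
    (hEd : ∀ w : Fin d → ℤ, ‖EB (aliasPt p w) - EA (aliasPt p w)‖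
      ≤ (rE * ((L ^ k : ℕ) : ℝ) ^ (-γ) + sE * δ ^ γ) * ‖aliasPt p w‖ ^ (β + γ)) :
    (∑ j ∈ J, ∑ b ∈ B.erase 0,
        ‖fmodeTerm (DeltaEff (aK a L (k + n)) (L ^ n * L ^ k) M p) (((L ^ n : ℕ) : ℝ) * ((L ^ k : ℕ) : ℝ))⁻¹ M
          (aliasPt p (j + ((L ^ k : ℕ) : ℤ) • b)) ξ' EB‖)
      + ∑ j ∈ J, ‖fmodeTerm (DeltaEff (aK a L (k + n)) (L ^ n * L ^ k) M p) (((L ^ n : ℕ) : ℝ) * ((L ^ k : ℕ) : ℝ))⁻¹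
            M (aliasPt p j) ξ' EB
          - fmodeTerm (DeltaEff (aK a L k) (L ^ k) M p) (((L ^ k : ℕ) : ℝ))⁻¹ M (aliasPt p j) ξ EA‖
      ≤ fprop38RateConst a a (lemma43Const a L k n) ((π ^ 2 / 4) ^ d) d γ β cE rE * ((L ^ k : ℕ) : ℝ) ^ (-γ)
        + fprop38PosConst a ((π ^ 2 / 4) ^ d) d γ β cE sE * δ ^ γ := by
  have hL0 : L ≠ 0 := by omega
  haveI : NeZero (L ^ k) := ⟨pow_ne_zero _ hL0⟩
  have hLr : (1 : ℝ) < L := by exact_mod_cast (lt_of_lt_of_le one_lt_two hL)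
  have hNk : 1 ≤ L ^ k := Nat.one_le_pow _ _ (by omega)
  have hNn : 1 ≤ L ^ n := Nat.one_le_pow _ _ (by omega)
  have hΔA0 : 0 ≤ DeltaEff (aK a L k) (L ^ k) M p := DeltaEff_nonneg (aK_pos ha hLr hk).le _ hM.le p
  have hΔAa : DeltaEff (aK a L k) (L ^ k) M p ≤ a :=
    (DeltaEff_le (aK_pos ha hLr hk) _ hM.le p).trans (aK_le ha hLr hk)
  have hΔB0 : 0 ≤ DeltaEff (aK a L (k + n)) (L ^ n * L ^ k) M p :=
    DeltaEff_nonneg (aK_pos ha hLr (by omega)).le _ hM.le p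
  have hΔBa : DeltaEff (aK a L (k + n)) (L ^ n * L ^ k) M p ≤ a :=
    (DeltaEff_le (aK_pos ha hLr (by omega)) _ hM.le p).trans (aK_le ha hLr (by omega))
  have h43 := lemma43_aK_rel ha hL hk hn hM.le hp
  have hcen := DeltaEff_le_mul_latticeSymbol_of_mass (aK_pos ha hLr hk) hNk hM hp
  exact alias_sums_two_spacing_factor_le hd hNk hNn hM.le hγ0 hγ1 hβ hβγ hΔA0 hΔAa hΔB0 hΔBa
    (lemma43Const_nonneg ha hL hk hn) (by positivity) h43 hp hcen hJ hB hδ hξ hcE hrE hsE hEB hEd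

end KingSymbols

end Literature.MathematicalPhysics.QuantumFieldTheory.King1986
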